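import Summits.NavierStokesRegularity.NavierStokesRegularity.Theorems.PoloidalWindowDoorPoloidalWindowRigidityZShockObliqueProfile
import Summits.NavierStokesRegularity.NavierStokesRegularity.Theorems.PoloidalWindowDoorPoloidalWindowRigidityZShockMonotoneExtension
import HarnessLib

/-!
# Crux K2 `PoloidalWindowRigidity` (stmt-NavierStokesRegularity-19708), line `z_shock` — RANGE-LOCAL R2 / R2½, THE OTHER SIGN OF THE
# GENUINE NONLINEARITY (`κ' ≤ 0`, `γ' ≤ 0` on the value hull)

`--supports stmt-NavierStokesRegularity-19708 --as helper` (leafhand-ns-poloidalwindowdoor-3 g8, cell decomp-ns, 2026-08-31).  Class-free,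
def-free, Mathlib + tree files only.  **No stub and no summit is closed by this file; Navier–Stokes regularity is NOT proved here (rung 0).**

Companion of `…ZShockRangeLocal` (the `κ' ≥ 0` / `γ' ≥ 0` case).  The thick column of the crux has `G''` of EITHER sign; the tree's
Liouville rungs come in both signs (`…ZShockScalarWaveLiouville.scalarWave_const_nonuniform_antitone`,
`…ZShockObliqueProfile.obliqueProfile_const_of_supersonic_antitone`), again with GLOBAL hypotheses on the structure function.  Here:

* `exists_antitone_gn_extension` — the mirror of `…ZShockMonotoneExtension.exists_monotone_gn_extension` (by the reflection `v ↦ −v`):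
  `κ` differentiable on `[A, B]` with continuous derivative `−S ≤ κ' ≤ 0` not identically zero on open subintervals extends, for every
  `δ > 0`, to `κ̃ : ℝ → ℝ` with `κ̃ = κ`, `κ̃' = κ'` on `[A, B]`, `HasDerivAt` everywhere, `κ̃'` continuous, `−(S+δ) ≤ κ̃' ≤ 0`, `κ̃'` not
  identically zero on ANY interval, `κ̃` antitone, `κ B − δ ≤ κ̃ ≤ κ A + δ`;
* `scalarWave_const_rangeLocal_antitone` — ★ R2, scalar currency, `κ' ≤ 0` on the hull, every structure hypothesis on `[A, B]` only;
* `obliqueProfile_const_of_supersonic_rangeLocal_antitone` — ★ R2½, supersonic oblique profiles, `γ' ≤ 0` on the hull.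

[folklore] (elementary real analysis + the tree's two-sided Lax/John theorems.)
-/

noncomputable section

namespace Summit.NavierStokesRegularity.NavierStokesRegularity.Theorems.PoloidalWindowDoorPoloidalWindowRigidityZShockRangeLocalAntitone

-- the summit and its single sub-problem share the name (CONVENTIONS §1)
set_option linter.dupNamespace false

open Set Filter Topology Function intervalIntegral
open Summit.NavierStokesRegularity.NavierStokesRegularity.Theorems.PoloidalWindowDoorPoloidalWindowRigidityZShockScalarWaveLiouville
open Summit.NavierStokesRegularity.NavierStokesRegularity.Theorems.PoloidalWindowDoorPoloidalWindowRigidityZShockObliqueProfile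
open Summit.NavierStokesRegularity.NavierStokesRegularity.Theorems.PoloidalWindowDoorPoloidalWindowRigidityZShockMonotoneExtension

/-! ### The antitone extension lemma -/

/-- ★ **Antitone, genuinely-nonlinear `C¹` extension off a compact value hull** (mirror image of `exists_monotone_gn_extension` under
`v ↦ −v`). [folklore] -/
theorem exists_antitone_gn_extension {κ κ' : ℝ → ℝ} {A B S δ : ℝ} (hAB : A ≤ B) (hδ : 0 < δ)
    (hκd : ∀ v ∈ Icc A B, HasDerivAt κ (κ' v) v) (hκ'c : ContinuousOn κ' (Icc A B))
    (hgnl : ∀ v ∈ Icc A B, κ' v ≤ 0) (hS : ∀ v ∈ Icc A B, -S ≤ κ' v)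
    (hgn : ∀ a b : ℝ, A ≤ a → a < b → b ≤ B → ∃ v ∈ Ioo a b, κ' v ≠ 0) :
    ∃ κe κe' : ℝ → ℝ, (∀ v ∈ Icc A B, κe v = κ v) ∧ (∀ v ∈ Icc A B, κe' v = κ' v) ∧
      (∀ v, HasDerivAt κe (κe' v) v) ∧ Continuous κe' ∧ (∀ v, κe' v ≤ 0) ∧ (∀ v, -(S + δ) ≤ κe' v) ∧
      (∀ a b : ℝ, a < b → ∃ v ∈ Ioo a b, κe' v ≠ 0) ∧ Antitone κe ∧
      (∀ v, κ B - δ ≤ κe v) ∧ (∀ v, κe v ≤ κ A + δ) := by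
  -- the reflected structure function `λ v = κ (−v)` on `[−B, −A]`
  have hmem : ∀ u ∈ Icc (-B) (-A), -u ∈ Icc A B := fun u hu => ⟨by linarith [hu.2], by linarith [hu.1]⟩
  have hld : ∀ u ∈ Icc (-B) (-A), HasDerivAt (fun u => κ (-u)) (-κ' (-u)) u := by
    intro u hu
    have h : HasDerivAt (fun u => κ (-u)) (κ' (-u) * -1) u := (hκd (-u) (hmem u hu)).comp u (hasDerivAt_neg u)
    exact h.congr_deriv (by ring)
  have hl'c : ContinuousOn (fun u => -κ' (-u)) (Icc (-B) (-A)) :=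
    (hκ'c.comp continuous_neg.continuousOn fun u hu => hmem u hu).neg
  obtain ⟨lam, lam', hlam_on, hlam'_on, hlamd, hlam'c, hlam'0, hlam'S, hlam_gn, hlam_mono, hlam_lo, hlam_hi⟩ :=
    exists_monotone_gn_extension (κ := fun u => κ (-u)) (κ' := fun u => -κ' (-u)) (S := S)
      (neg_le_neg hAB) hδ hld hl'c
      (fun u hu => by linarith [hgnl (-u) (hmem u hu)]) (fun u hu => by linarith [hS (-u) (hmem u hu)])
      (fun a b ha hab hb => by
        obtain ⟨v, hv, hv0⟩ := hgn (-b) (-a) (by linarith) (by linarith) (by linarith)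
        exact ⟨-v, ⟨by linarith [hv.2], by linarith [hv.1]⟩, by simpa using hv0⟩)
  refine ⟨fun v => lam (-v), fun v => -lam' (-v), ?_, ?_, ?_, ?_, ?_, ?_, ?_, ?_, ?_, ?_⟩
  · intro v hv
    have h := hlam_on (-v) ⟨by linarith [hv.2], by linarith [hv.1]⟩
    simpa using h
  · intro v hv
    have h := hlam'_on (-v) ⟨by linarith [hv.2], by linarith [hv.1]⟩
    simp only [h, neg_neg]
  · intro v
    have h : HasDerivAt (fun v => lam (-v)) (lam' (-v) * -1) v := (hlamd (-v)).comp v (hasDerivAt_neg v)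
    exact h.congr_deriv (by ring)
  · exact (hlam'c.comp continuous_neg).neg
  · intro v
    have := hlam'0 (-v)
    linarith
  · intro v
    have := hlam'S (-v)
    linarith
  · intro a b hab
    obtain ⟨u, hu, hu0⟩ := hlam_gn (-b) (-a) (by linarith)
    exact ⟨-u, ⟨by linarith [hu.2], by linarith [hu.1]⟩, by simpa using hu0⟩
  · exact fun v v' hvv' => hlam_mono (neg_le_neg hvv')
  · intro v
    have h := hlam_lo (-v)
    simpa using h
  · intro v
    have h := hlam_hi (-v)
    simpa using h

/-! ### Range-local R2, scalar currency, `κ' ≤ 0` -/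

/-- ★ **R2, scalar currency, RANGE-LOCAL, `κ' ≤ 0` on the hull.**  As `…ZShockRangeLocal.scalarWave_const_rangeLocal` with the other sign
of the genuine nonlinearity: `w` two-sided `C²` solution of `w_zz = ∂ₓ(κ(w)² w_x)` with values in `[A, B]`, `w_x, w_z` bounded; `κ`
differentiable on `[A, B]` with continuous derivative, `κ ≥ κlo > 0`, `−k₁ ≤ κ' ≤ 0`, `κ'` not identically zero on open subintervals of
`[A, B]`.  Then `w` is constant (via the tree's `scalarWave_const_nonuniform_antitone`). [folklore] -/
theorem scalarWave_const_rangeLocal_antitone {w : ℝ × ℝ → ℝ} {κ κ' : ℝ → ℝ} {A B κlo k₁ W₁ W₂ : ℝ}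
    (hw : ContDiff ℝ 2 w) (hrange : ∀ q, w q ∈ Icc A B)
    (hκd : ∀ v ∈ Icc A B, HasDerivAt κ (κ' v) v) (hκ'c : ContinuousOn κ' (Icc A B))
    (hpde : ∀ q : ℝ × ℝ, fderiv ℝ (fun q' => fderiv ℝ w q' (1, 0)) q (1, 0) =
      fderiv ℝ (fun q' => κ (w q') ^ 2 * fderiv ℝ w q' (0, 1)) q (0, 1))
    (hκlo0 : 0 < κlo) (hκlo : ∀ v ∈ Icc A B, κlo ≤ κ v)
    (hgnl : ∀ v ∈ Icc A B, κ' v ≤ 0) (hgn : ∀ a b : ℝ, A ≤ a → a < b → b ≤ B → ∃ v ∈ Ioo a b, κ' v ≠ 0)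
    (hk₁ : ∀ v ∈ Icc A B, |κ' v| ≤ k₁)
    (hW₁ : ∀ q, |fderiv ℝ w q (0, 1)| ≤ W₁) (hW₂ : ∀ q, |fderiv ℝ w q (1, 0)| ≤ W₂) :
    ∀ q q' : ℝ × ℝ, w q = w q' := by
  have hAB : A ≤ B := (hrange 0).1.trans (hrange 0).2
  have hB : B ∈ Icc A B := ⟨hAB, le_rfl⟩
  have hS : ∀ v ∈ Icc A B, -k₁ ≤ κ' v := fun v hv => (abs_le.1 (hk₁ v hv)).1
  obtain ⟨κe, κe', hκe_on, hκe'_on, hκed, hκe'c, hκe'0, hκe'S, hκe_gn, -, hκe_lo, hκe_hi⟩ :=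
    exists_antitone_gn_extension hAB (half_pos hκlo0) hκd hκ'c hgnl hS hgn
  obtain ⟨K, hK2, hKd⟩ := exists_contDiff_two_primitive hκed hκe'c
  have hfun : (fun q' => κe (w q') ^ 2 * fderiv ℝ w q' (0, 1)) = fun q' => κ (w q') ^ 2 * fderiv ℝ w q' (0, 1) :=
    funext fun q' => by rw [hκe_on _ (hrange q')]
  have hpde' : ∀ q : ℝ × ℝ, fderiv ℝ (fun q' => fderiv ℝ w q' (1, 0)) q (1, 0) =
      fderiv ℝ (fun q' => κe (w q') ^ 2 * fderiv ℝ w q' (0, 1)) q (0, 1) := fun q => by rw [hfun]; exact hpde q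
  have hκB : κlo ≤ κ B := hκlo B hB
  exact scalarWave_const_nonuniform_antitone (κ := κe) (κ' := κe') (K := K) (κlo := κlo) (κhi := κ A + κlo / 2)
    (k₁ := k₁ + κlo / 2) (W₁ := W₁) (W₂ := W₂) (Mw := max |A| |B|) hw hK2 hKd hκed hκe'c hpde' hκlo0
    (fun q => by rw [hκe_on _ (hrange q)]; exact hκlo _ (hrange q)) (fun q => hκe_hi _)
    (fun v => by linarith [hκe_lo v]) hκe'0 hκe_gn
    (fun q => by rw [hκe'_on _ (hrange q)]; linarith [hk₁ _ (hrange q)]) hW₁ hW₂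
    (fun q => abs_le_max_abs_abs (hrange q).1 (hrange q).2)

/-! ### Range-local R2½, `γ' ≤ 0` -/

/-- ★ **R2½ RANGE-LOCAL, `γ' ≤ 0` on the hull.**  As `…ZShockRangeLocal.obliqueProfile_const_of_supersonic_rangeLocal` with the other
sign: `Φ` a `C²` supersonic oblique profile with values in `[A, B]`, `γ` differentiable on `[A, B]` with continuous derivative,
`0 < γlo ≤ γ < κ₀²`, `−g₁ ≤ γ' ≤ 0`, `γ'` not identically zero on open subintervals — all on `[A, B]`.  Then `Φ` is constant (extension
with `δ = min(γlo/2, (κ₀² − γ(A))/2)`, tree `obliqueProfile_const_of_supersonic_antitone`). [folklore] -/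
theorem obliqueProfile_const_of_supersonic_rangeLocal_antitone {Φ : ℝ × ℝ → ℝ} {γ γ' : ℝ → ℝ} {A B κ₀ γlo g₁ Φ₁ Φ₂ : ℝ}
    (hΦ : ContDiff ℝ 2 Φ) (hrange : ∀ q, Φ q ∈ Icc A B)
    (hγd : ∀ r ∈ Icc A B, HasDerivAt γ (γ' r) r) (hγ'c : ContinuousOn γ' (Icc A B))
    (hpde : ∀ q : ℝ × ℝ, fderiv ℝ (fun q' => γ (Φ q') * fderiv ℝ Φ q' (1, 0)) q (1, 0) =
      fderiv ℝ (fun q' => (κ₀ ^ 2 - γ (Φ q')) * fderiv ℝ Φ q' (0, 1)) q (0, 1))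
    (hγlo0 : 0 < γlo) (hγlo : ∀ r ∈ Icc A B, γlo ≤ γ r) (hsuper : ∀ r ∈ Icc A B, γ r < κ₀ ^ 2)
    (hgnl : ∀ r ∈ Icc A B, γ' r ≤ 0) (hgn : ∀ a b : ℝ, A ≤ a → a < b → b ≤ B → ∃ r ∈ Ioo a b, γ' r ≠ 0)
    (hg₁ : ∀ r ∈ Icc A B, |γ' r| ≤ g₁)
    (hΦ₁ : ∀ q, |fderiv ℝ Φ q (0, 1)| ≤ Φ₁) (hΦ₂ : ∀ q, |fderiv ℝ Φ q (1, 0)| ≤ Φ₂) :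
    ∀ q q' : ℝ × ℝ, Φ q = Φ q' := by
  have hAB : A ≤ B := (hrange 0).1.trans (hrange 0).2
  have hA : A ∈ Icc A B := ⟨le_rfl, hAB⟩
  have hB : B ∈ Icc A B := ⟨hAB, le_rfl⟩
  have hS : ∀ r ∈ Icc A B, -g₁ ≤ γ' r := fun r hr => (abs_le.1 (hg₁ r hr)).1
  have hγA : γ A < κ₀ ^ 2 := hsuper A hA
  set δ : ℝ := min (γlo / 2) ((κ₀ ^ 2 - γ A) / 2) with hδ_def
  have hδ : 0 < δ := lt_min (half_pos hγlo0) (by linarith)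
  have hδ1 : δ ≤ γlo / 2 := min_le_left _ _
  have hδ2 : δ ≤ (κ₀ ^ 2 - γ A) / 2 := min_le_right _ _
  obtain ⟨γe, γe', hγe_on, hγe'_on, hγed, hγe'c, hγe'0, hγe'S, hγe_gn, -, hγe_lo, hγe_hi⟩ :=
    exists_antitone_gn_extension hAB hδ hγd hγ'c hgnl hS hgn
  obtain ⟨Γ, hΓ2, hΓd⟩ := exists_contDiff_two_primitive hγed hγe'c
  have hfun1 : (fun q' => γe (Φ q') * fderiv ℝ Φ q' (1, 0)) = fun q' => γ (Φ q') * fderiv ℝ Φ q' (1, 0) :=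
    funext fun q' => by rw [hγe_on _ (hrange q')]
  have hfun2 : (fun q' => (κ₀ ^ 2 - γe (Φ q')) * fderiv ℝ Φ q' (0, 1)) = fun q' => (κ₀ ^ 2 - γ (Φ q')) * fderiv ℝ Φ q' (0, 1) :=
    funext fun q' => by rw [hγe_on _ (hrange q')]
  have hpde' : ∀ q : ℝ × ℝ, fderiv ℝ (fun q' => γe (Φ q') * fderiv ℝ Φ q' (1, 0)) q (1, 0) =
      fderiv ℝ (fun q' => (κ₀ ^ 2 - γe (Φ q')) * fderiv ℝ Φ q' (0, 1)) q (0, 1) := fun q => by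
    rw [hfun1, hfun2]; exact hpde q
  have hγB : γlo ≤ γ B := hγlo B hB
  exact obliqueProfile_const_of_supersonic_antitone (γ := γe) (γ' := γe') (Γ := Γ) (γlo := γlo / 2) (γhi := γ A + δ)
    (g₁ := g₁ + δ) (Φ₁ := Φ₁) (Φ₂ := Φ₂) (MΦ := max |A| |B|) hΦ hΓ2 hΓd hγed hγe'c hpde' (half_pos hγlo0)
    (fun r => by linarith [hγe_lo r]) (fun r => hγe_hi r) (by linarith) hγe'0 hγe_gn
    (fun r => by rw [abs_of_nonpos (hγe'0 r)]; linarith [hγe'S r]) hΦ₁ hΦ₂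
    (fun q => abs_le_max_abs_abs (hrange q).1 (hrange q).2)

end Summit.NavierStokesRegularity.NavierStokesRegularity.Theorems.PoloidalWindowDoorPoloidalWindowRigidityZShockRangeLocalAntitone

end
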